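import Summits.Ventures.Crystal3D.Theorems.StickyWulffConstantGenericWallFloorRegisteredResidualWide
import Summits.Ventures.Crystal3D.Theorems.StickyWulffConstantGenericWallFloorAtDirs
import Summits.Ventures.Crystal3D.Theorems.StickyWulffConstantGenericWallFloorAtDirsDown
import Summits.Ventures.Crystal3D.Theorems.StickyWulffConstantGenericWallFloorOfP5Exhaustion
import HarnessLib

/-!
# Lane G at charge `c₀`: the named coverage fact `ResidualOneSidedCoverage c₀` and the pure-dispatch closer
# (crux `GenericWallFloor`, stmt-Ventures-19480, line `WallLedgerG`; cf-p1 DECISIONS (lxiii)(a), (lxv), word GO 00:07Z)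

HONEST FRAMING. Venture `Summits/Ventures/Crystal3D` (cell `crystal3d-full`), helper `--supports` the crux `GenericWallFloor` of
`route-Ventures-StickyWulffConstant`, REGISTERED line `WallLedgerG`, open stub `stub_twoSlabAdhesion`.  DEFINITIONS + BOOKKEEPING;
rung credit only; F-C1 not moved; NOT the crux: the charge is `c₀ ≤ 1` (the law's `11/20` or `13/25`), not `1`, and THREE
named inputs stay BY NAME — the certified computations `P5Exhaustion` (E1, C12-55) and `StarPairFar`, and the NEW named
computational fact `ResidualOneSidedCoverage c₀` typed here (its certificate — per reduced word, ALL lengths, a finite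
polygon list in the wall normal with one fixed steering per polygon; the words of length `≥ L₀` form the deep-arrival tail of
cf-p1 (lxvi) — is PRE-REGISTERED (`PREREG-ResidualOneSidedCoverage-g12.md`), not in the kernel; numbers of record: seat
19480-p1 g12, kit j320436/529/580/689/723/790/921/924/968/971, memo `GCL-NU-HALF-g12.md`).

WHAT IS HERE.
* `OneSidedFamilyUpAt c₀ A₁ A₂` / `OneSidedFamilyDownAt c₀ A₁ A₂` — VERBATIM the hypothesis bundles of the landed one-sided
  ledgers `genericWallFloorAtCharge_oneSided_dirs` (grain 1 walking up: unit steering `z`, `z`-steep slot `u₁`, true rise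
  `√2·c₀ ≤ (A₁u₁)₂`, `hmiss`, `hdirs`) and `genericWallFloorAtCharge_oneSidedDown_dirs` (grain 2 walking down);
  `SeparatedTiltAtCharge c₀ A₁ A₂` — the class `SeparatedWideAt` with its flux floor `2` replaced by `2c₀` (the hypothesis
  bundle of `twoSlabAdhesion_stackLedger_local_sep_wide` at charge `(κ₁ + κ₂)/2 ≥ c₀`); `CoveredAtCharge c₀ A₁ A₂` — their
  disjunction; `genericWallFloorAtCharge_of_coveredAtCharge` — covered pairs satisfy `GenericWallFloorAtCharge c₀` for ALL
  translations (pure dispatch to the three ledgers + `genericWallFloorAtCharge_mono`).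
* **`ResidualOneSidedCoverage c₀`** — THE NAMED FACT: every pair of frames that is not Barlow-co-axial, is ray-aligned
  (`RayAlignedAt`), lies in none of the six priced one-sided `Σ9` classes and outside `SeparatedWideAt` — i.e. every
  orientation pair of lane G's residual of record `GenericWallFloorRegisteredResidualWide` — is `CoveredAtCharge c₀`.
  Monotone in `c₀` (`residualOneSidedCoverage_mono`).
* **`genericWallFloorAtCharge_all_of_coverage`** — THE LANE-G CLOSER AT CHARGE `c₀ ∈ (0, 1]`:
  `P5Exhaustion → StarPairFar → ResidualOneSidedCoverage c₀ → ∀ A₁ t₁ A₂ t₂ non-co-axial, GenericWallFloorAtCharge c₀ A₁ t₁ A₂ t₂`,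
  by excluded middle along the residual chain (`¬ RayAlignedAt` ⇒ `genericWallFloorAt_chain_of_far`; a `Σ9` class ⇒ its
  landed floor; `SeparatedWideAt` ⇒ `genericWallFloorAt_of_separatedWideAt`; all at charge `1 ≥ c₀`; else the fact).
WHAT THIS IS NOT: a proof of `ResidualOneSidedCoverage c₀` for any `c₀`; not `c₀ = 1`; F-C1 not moved.
-/

noncomputable section

namespace Summit.Ventures.Crystal3D.Theorems

open Summit.Ventures.Crystal3D Finset
open Literature.MathematicalPhysics.StatisticalMechanics (fccStacking barlowStacking IsHaggSeq)
open scoped InnerProductSpace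

/-! ### The three covering mechanisms at charge `c₀`, as named hypothesis bundles -/

/-- **One-sided family of grain 1 walking UP at charge `c₀`** — verbatim the hypotheses of
`genericWallFloorAtCharge_oneSided_dirs` with `δ = √2·c₀`: a unit steering `z`, a `z`-steep slot `u₁` of grain 1 with true
rise `(A₁u₁)₂ ≥ √2·c₀`, no frame of a sound well-formed `z`-stack over `⟨A₁, u₁, 0⟩` carrying grain 2's lattice (`hmiss`),
and the weak direction floor on the top entry of every such stack (`hdirs`). -/
def OneSidedFamilyUpAt (c₀ : ℝ) (A₁ A₂ : EuclideanSpace ℝ (Fin 3) ≃ₗᵢ[ℝ] EuclideanSpace ℝ (Fin 3)) : Prop :=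
  ∃ z u₁ : EuclideanSpace ℝ (Fin 3), ‖z‖ = 1 ∧ u₁ ∈ fccSlots ∧ Real.sqrt 2 / 2 ≤ ⟪A₁ u₁, z⟫_ℝ ∧
    Real.sqrt 2 * c₀ ≤ (A₁ u₁) 2 ∧
    (∀ stk : List WalkEntry, StackSound z stk → StackWF z stk → stk.getLast? = some ⟨A₁, u₁, 0⟩ →
      ∀ e ∈ stk, e.frame '' fccStacking 1 (Real.sqrt (2 / 3)) ≠ A₂ '' fccStacking 1 (Real.sqrt (2 / 3))) ∧
    (∀ stk : List WalkEntry, StackSound z stk → StackWF z stk → stk.getLast? = some ⟨A₁, u₁, 0⟩ →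
      ∀ e rest, stk = e :: rest → 0 ≤ (e.frame e.dir) 2)

/-- **One-sided family of grain 2 walking DOWN at charge `c₀`** — verbatim the hypotheses of
`genericWallFloorAtCharge_oneSidedDown_dirs` with `δ = √2·c₀`. -/
def OneSidedFamilyDownAt (c₀ : ℝ) (A₁ A₂ : EuclideanSpace ℝ (Fin 3) ≃ₗᵢ[ℝ] EuclideanSpace ℝ (Fin 3)) : Prop :=
  ∃ z u₂ : EuclideanSpace ℝ (Fin 3), ‖z‖ = 1 ∧ u₂ ∈ fccSlots ∧ Real.sqrt 2 / 2 ≤ ⟪A₂ u₂, z⟫_ℝ ∧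
    Real.sqrt 2 * c₀ ≤ -(A₂ u₂) 2 ∧
    (∀ stk : List WalkEntry, StackSound z stk → StackWF z stk → stk.getLast? = some ⟨A₂, u₂, 0⟩ →
      ∀ e ∈ stk, e.frame '' fccStacking 1 (Real.sqrt (2 / 3)) ≠ A₁ '' fccStacking 1 (Real.sqrt (2 / 3))) ∧
    (∀ stk : List WalkEntry, StackSound z stk → StackWF z stk → stk.getLast? = some ⟨A₂, u₂, 0⟩ →
      ∀ e rest, stk = e :: rest → (e.frame e.dir) 2 ≤ 0)

/-- **Tilted separated slot pair at charge `c₀`** — the class `SeparatedWideAt A₁ A₂` verbatim with its flux floor `2 ≤ …`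
replaced by `2c₀ ≤ …` (the hypotheses of `twoSlabAdhesion_stackLedger_local_sep_wide`, whose charge is `(κ₁ + κ₂)/2`). -/
def SeparatedTiltAtCharge (c₀ : ℝ) (A₁ A₂ : EuclideanSpace ℝ (Fin 3) ≃ₗᵢ[ℝ] EuclideanSpace ℝ (Fin 3)) : Prop :=
  ∃ (z₁ z₂ u₁ u₂ : EuclideanSpace ℝ (Fin 3)), ‖z₁‖ = 1 ∧ ‖z₁ - EuclideanSpace.single (2 : Fin 3) (1 : ℝ)‖ ≤ 1 / 3 ∧
    ‖z₂‖ = 1 ∧ ‖z₂ + EuclideanSpace.single (2 : Fin 3) (1 : ℝ)‖ ≤ 1 / 3 ∧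
    u₁ ∈ fccSlots ∧ Real.sqrt 2 / 2 ≤ ⟪A₁ u₁, z₁⟫_ℝ ∧ u₂ ∈ fccSlots ∧ Real.sqrt 2 / 2 ≤ ⟪A₂ u₂, z₂⟫_ℝ ∧
    2 * c₀ ≤ Real.sqrt 2 * |⟪A₁ u₁, EuclideanSpace.single (2 : Fin 3) (1 : ℝ)⟫_ℝ| +
      Real.sqrt 2 * |⟪A₂ u₂, EuclideanSpace.single (2 : Fin 3) (1 : ℝ)⟫_ℝ| ∧
    ∀ stk₁ : List WalkEntry, StackSound z₁ stk₁ → StackWF z₁ stk₁ → stk₁.getLast? = some ⟨A₁, u₁, 0⟩ →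
    ∀ e₁ ∈ stk₁,
    ∀ stk₂ : List WalkEntry, StackSound z₂ stk₂ → StackWF z₂ stk₂ → stk₂.getLast? = some ⟨A₂, u₂, 0⟩ →
    ∀ e₂ ∈ stk₂,
      ¬ ∃ (L : EuclideanSpace ℝ (Fin 3) ≃ₗᵢ[ℝ] EuclideanSpace ℝ (Fin 3)) (s₁ s₂ : EuclideanSpace ℝ (Fin 3))
          (σ σ' : ℤ → ℤ), IsHaggSeq σ ∧ IsHaggSeq σ' ∧
        e₁.frame '' fccStacking 1 (Real.sqrt (2 / 3)) ⊆
          (fun p => L p + s₁) '' barlowStacking 1 (Real.sqrt (2 / 3)) σ ∧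
        e₂.frame '' fccStacking 1 (Real.sqrt (2 / 3)) ⊆
          (fun p => L p + s₂) '' barlowStacking 1 (Real.sqrt (2 / 3)) σ'

/-- **Covered at charge `c₀`**: one of the three priced mechanisms applies to the orientation pair `(A₁, A₂)`. -/
def CoveredAtCharge (c₀ : ℝ) (A₁ A₂ : EuclideanSpace ℝ (Fin 3) ≃ₗᵢ[ℝ] EuclideanSpace ℝ (Fin 3)) : Prop :=
  OneSidedFamilyUpAt c₀ A₁ A₂ ∨ OneSidedFamilyDownAt c₀ A₁ A₂ ∨ SeparatedTiltAtCharge c₀ A₁ A₂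

/-- **`ResidualOneSidedCoverage c₀` — THE NAMED COMPUTATIONAL FACT of lane G at charge `c₀`.**  Every pair of frames
`(A₁, A₂)` whose lattices are NOT Barlow-co-axial (no common linear Barlow frame up to translations), that is RAY-ALIGNED,
in none of the six priced one-sided `Σ9` classes, and outside the wide separated class — the orientation pairs of the
residual of record `GenericWallFloorRegisteredResidualWide` — is covered at charge `c₀`.  CERTIFICATE (pre-registered,
NOT in the kernel): per reduced model word `κ` presenting `A₂·Λ₀` over `A₁` (all lengths; the words of length `≥ L₀` are the
deep-arrival tail of cf-p1 (lxvi)) the residual is a finite union of spherical polygons in the wall normal, each carrying one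
fixed steering `z` and slot for which the four conditions are finitely many linear inequalities; numbers of record at
`c₀ = 11/20`: minimum certified charge `5√2/12 ≈ 0.589` (the `Σ9` terrace centre), terrace-capstone-only `0.5715` on the
`Σ27` boundary band. -/
def ResidualOneSidedCoverage (c₀ : ℝ) : Prop :=
  ∀ (A₁ A₂ : EuclideanSpace ℝ (Fin 3) ≃ₗᵢ[ℝ] EuclideanSpace ℝ (Fin 3)),
    ¬ (∃ (L : EuclideanSpace ℝ (Fin 3) ≃ₗᵢ[ℝ] EuclideanSpace ℝ (Fin 3)) (s₁ s₂ : EuclideanSpace ℝ (Fin 3))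
        (σ σ' : ℤ → ℤ), IsHaggSeq σ ∧ IsHaggSeq σ' ∧
        A₁ '' fccStacking 1 (Real.sqrt (2 / 3)) ⊆ (fun p => L p + s₁) '' barlowStacking 1 (Real.sqrt (2 / 3)) σ ∧
        A₂ '' fccStacking 1 (Real.sqrt (2 / 3)) ⊆ (fun p => L p + s₂) '' barlowStacking 1 (Real.sqrt (2 / 3)) σ') →
    RayAlignedAt A₁ A₂ → ¬ Sigma9OneSidedAt A₁ A₂ → ¬ Sigma9OneSidedDownAt A₁ A₂ →
    ¬ Sigma9TiltAt A₁ A₂ → ¬ Sigma9TiltDownAt A₁ A₂ → ¬ Sigma9WideAt A₁ A₂ → ¬ Sigma9WideDownAt A₁ A₂ →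
    ¬ SeparatedWideAt A₁ A₂ → CoveredAtCharge c₀ A₁ A₂

/-! ### Monotonicity in the charge -/

/-- Lowering the charge keeps an up-family. -/
theorem oneSidedFamilyUpAt_mono {c₀ c₀' : ℝ} (hle : c₀' ≤ c₀)
    {A₁ A₂ : EuclideanSpace ℝ (Fin 3) ≃ₗᵢ[ℝ] EuclideanSpace ℝ (Fin 3)} (h : OneSidedFamilyUpAt c₀ A₁ A₂) :
    OneSidedFamilyUpAt c₀' A₁ A₂ := by
  obtain ⟨z, u₁, hz, hu₁, hsteep, hrise, hmiss, hdirs⟩ := h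
  exact ⟨z, u₁, hz, hu₁, hsteep, (mul_le_mul_of_nonneg_left hle (Real.sqrt_nonneg 2)).trans hrise, hmiss, hdirs⟩

/-- Lowering the charge keeps a down-family. -/
theorem oneSidedFamilyDownAt_mono {c₀ c₀' : ℝ} (hle : c₀' ≤ c₀)
    {A₁ A₂ : EuclideanSpace ℝ (Fin 3) ≃ₗᵢ[ℝ] EuclideanSpace ℝ (Fin 3)} (h : OneSidedFamilyDownAt c₀ A₁ A₂) :
    OneSidedFamilyDownAt c₀' A₁ A₂ := by
  obtain ⟨z, u₂, hz, hu₂, hsteep, hdown, hmiss, hdirs⟩ := h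
  exact ⟨z, u₂, hz, hu₂, hsteep, (mul_le_mul_of_nonneg_left hle (Real.sqrt_nonneg 2)).trans hdown, hmiss, hdirs⟩

/-- Lowering the charge keeps a separated tilted pair. -/
theorem separatedTiltAtCharge_mono {c₀ c₀' : ℝ} (hle : c₀' ≤ c₀)
    {A₁ A₂ : EuclideanSpace ℝ (Fin 3) ≃ₗᵢ[ℝ] EuclideanSpace ℝ (Fin 3)} (h : SeparatedTiltAtCharge c₀ A₁ A₂) :
    SeparatedTiltAtCharge c₀' A₁ A₂ := by
  obtain ⟨z₁, z₂, u₁, u₂, hz₁, hze₁, hz₂, hze₂, hu₁, hsteep₁, hu₂, hsteep₂, hflux, hsep⟩ := h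
  exact ⟨z₁, z₂, u₁, u₂, hz₁, hze₁, hz₂, hze₂, hu₁, hsteep₁, hu₂, hsteep₂, by linarith only [hflux, hle], hsep⟩

/-- Lowering the charge keeps coverage of a pair. -/
theorem coveredAtCharge_mono {c₀ c₀' : ℝ} (hle : c₀' ≤ c₀)
    {A₁ A₂ : EuclideanSpace ℝ (Fin 3) ≃ₗᵢ[ℝ] EuclideanSpace ℝ (Fin 3)} (h : CoveredAtCharge c₀ A₁ A₂) :
    CoveredAtCharge c₀' A₁ A₂ := by
  rcases h with h | h | h
  · exact Or.inl (oneSidedFamilyUpAt_mono hle h)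
  · exact Or.inr (Or.inl (oneSidedFamilyDownAt_mono hle h))
  · exact Or.inr (Or.inr (separatedTiltAtCharge_mono hle h))

/-- **Monotonicity of the named fact**: `ResidualOneSidedCoverage c₀ → c₀' ≤ c₀ → ResidualOneSidedCoverage c₀'`. -/
theorem residualOneSidedCoverage_mono {c₀ c₀' : ℝ} (h : ResidualOneSidedCoverage c₀) (hle : c₀' ≤ c₀) :
    ResidualOneSidedCoverage c₀' :=
  fun A₁ A₂ hnc hra h₁ h₂ h₃ h₄ h₅ h₆ h₇ => coveredAtCharge_mono hle (h A₁ A₂ hnc hra h₁ h₂ h₃ h₄ h₅ h₆ h₇)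

/-! ### Covered pairs satisfy the per-pair matrix at charge `c₀` (pure dispatch to the landed ledgers) -/

/-- `√2·c₀ ≤ r` gives `c₀ ≤ √2·r/2`. -/
theorem charge_le_of_sqrt_two_mul_le {c₀ r : ℝ} (h : Real.sqrt 2 * c₀ ≤ r) : c₀ ≤ Real.sqrt 2 * r / 2 := by
  have h2 : Real.sqrt 2 * Real.sqrt 2 = 2 := Real.mul_self_sqrt (by norm_num)
  have hnn : 0 ≤ Real.sqrt 2 / 2 * (r - Real.sqrt 2 * c₀) :=
    mul_nonneg (div_nonneg (Real.sqrt_nonneg 2) zero_le_two) (sub_nonneg.2 h)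
  have hid : Real.sqrt 2 * r / 2 - c₀ = Real.sqrt 2 / 2 * (r - Real.sqrt 2 * c₀) := by
    linear_combination (c₀ / 2) * h2
  linarith [hid, hnn]

open scoped Classical in
/-- **Covered pairs satisfy `GenericWallFloorAtCharge c₀` for ALL translations** (`0 < c₀`), modulo `ExactOnly`(C12-55) and
`StarPairFar`: an up-family ⇒ `genericWallFloorAtCharge_oneSided_dirs`; a down-family ⇒ `…_oneSidedDown_dirs`; a separated
tilted pair ⇒ `twoSlabAdhesion_stackLedger_local_sep_wide` + `genericWallFloorAtCharge_of_ledger`; then `…_mono`. -/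
theorem genericWallFloorAtCharge_of_coveredAtCharge
    {s₀ : EuclideanSpace ℝ (Fin 3)} (hs₀ : s₀ ∈ fccSlots)
    (hcert : ExactOnly 0 (fccSlots.filter fun w => 0 < ⟪w, s₀⟫_ℝ)) (hSP : StarPairFar)
    {c₀ : ℝ} (hc₀ : 0 < c₀)
    {A₁ A₂ : EuclideanSpace ℝ (Fin 3) ≃ₗᵢ[ℝ] EuclideanSpace ℝ (Fin 3)} (h : CoveredAtCharge c₀ A₁ A₂)
    (t₁ t₂ : EuclideanSpace ℝ (Fin 3)) : GenericWallFloorAtCharge c₀ A₁ t₁ A₂ t₂ := by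
  have hδ : 0 < Real.sqrt 2 * c₀ := by positivity
  rcases h with ⟨z, u₁, hz, hu₁, hsteep, hrise, hmiss, hdirs⟩ | ⟨z, u₂, hz, hu₂, hsteep, hdown, hmiss, hdirs⟩ |
    ⟨z₁, z₂, u₁, u₂, hz₁, hze₁, hz₂, hze₂, hu₁, hsteep₁, hu₂, hsteep₂, hflux, hsep⟩
  · exact genericWallFloorAtCharge_mono (charge_le_of_sqrt_two_mul_le hrise)
      (genericWallFloorAtCharge_oneSided_dirs hs₀ hcert hSP A₁ t₁ A₂ t₂ hz hu₁ hsteep hδ hrise hmiss hdirs)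
  · exact genericWallFloorAtCharge_mono (charge_le_of_sqrt_two_mul_le hdown)
      (genericWallFloorAtCharge_oneSidedDown_dirs hs₀ hcert hSP A₁ t₁ A₂ t₂ hz hu₂ hsteep hδ hdown hmiss hdirs)
  · exact genericWallFloorAtCharge_mono (by linarith only [hflux])
      (genericWallFloorAtCharge_of_ledger _ A₁ t₁ A₂ t₂
        (twoSlabAdhesion_stackLedger_local_sep_wide hs₀ hcert (doubleStarCoaxialAt_of_starPairFar hSP)
          (capPairCoaxial_of_starPairFar hSP) A₁ t₁ A₂ t₂ hz₁ hze₁ hz₂ hze₂ hu₁ hsteep₁ hu₂ hsteep₂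
          {F | ∃ stk : List WalkEntry, StackSound z₁ stk ∧ StackWF z₁ stk ∧ stk.getLast? = some ⟨A₁, u₁, 0⟩ ∧
            ∃ e ∈ stk, e.frame = F}
          {F | ∃ stk : List WalkEntry, StackSound z₂ stk ∧ StackWF z₂ stk ∧ stk.getLast? = some ⟨A₂, u₂, 0⟩ ∧
            ∃ e ∈ stk, e.frame = F}
          (fun stk hS hW hl e he => ⟨stk, hS, hW, hl, e, he, rfl⟩)
          (fun stk hS hW hl e he => ⟨stk, hS, hW, hl, e, he, rfl⟩)
          (fun _ ⟨stk₁, hS₁, hW₁, hl₁, e₁, he₁, hF₁⟩ _ ⟨stk₂, hS₂, hW₂, hl₂, e₂, he₂, hF₂⟩ => by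
            rw [← hF₁, ← hF₂]
            exact hsep stk₁ hS₁ hW₁ hl₁ e₁ he₁ stk₂ hS₂ hW₂ hl₂ e₂ he₂)))

/-! ### The lane-G closer at charge `c₀` -/

/-- Translations do not affect Barlow-co-axiality: a common frame for `A₁·Λ₀`, `A₂·Λ₀` is one for the translated lattices. -/
theorem coaxial_translate_of_frames {A₁ A₂ : EuclideanSpace ℝ (Fin 3) ≃ₗᵢ[ℝ] EuclideanSpace ℝ (Fin 3)} (t₁ t₂ : EuclideanSpace ℝ (Fin 3))
    (h : ∃ (L : EuclideanSpace ℝ (Fin 3) ≃ₗᵢ[ℝ] EuclideanSpace ℝ (Fin 3)) (s₁ s₂ : EuclideanSpace ℝ (Fin 3))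
        (σ σ' : ℤ → ℤ), IsHaggSeq σ ∧ IsHaggSeq σ' ∧
        A₁ '' fccStacking 1 (Real.sqrt (2 / 3)) ⊆ (fun p => L p + s₁) '' barlowStacking 1 (Real.sqrt (2 / 3)) σ ∧
        A₂ '' fccStacking 1 (Real.sqrt (2 / 3)) ⊆ (fun p => L p + s₂) '' barlowStacking 1 (Real.sqrt (2 / 3)) σ') :
    ∃ (L : EuclideanSpace ℝ (Fin 3) ≃ₗᵢ[ℝ] EuclideanSpace ℝ (Fin 3)) (s₁ s₂ : EuclideanSpace ℝ (Fin 3))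
        (σ σ' : ℤ → ℤ), IsHaggSeq σ ∧ IsHaggSeq σ' ∧
        (fun p => A₁ p + t₁) '' fccStacking 1 (Real.sqrt (2 / 3)) ⊆
          (fun p => L p + s₁) '' barlowStacking 1 (Real.sqrt (2 / 3)) σ ∧
        (fun p => A₂ p + t₂) '' fccStacking 1 (Real.sqrt (2 / 3)) ⊆
          (fun p => L p + s₂) '' barlowStacking 1 (Real.sqrt (2 / 3)) σ' := by
  obtain ⟨L, s₁, s₂, σ, σ', hσ, hσ', h₁, h₂⟩ := h
  refine ⟨L, s₁ + t₁, s₂ + t₂, σ, σ', hσ, hσ', ?_, ?_⟩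
  · rintro _ ⟨p, hp, rfl⟩
    obtain ⟨q, hq, hqp⟩ := h₁ ⟨p, hp, rfl⟩
    refine ⟨q, hq, ?_⟩
    simp only at hqp ⊢
    rw [← add_assoc, hqp]
  · rintro _ ⟨p, hp, rfl⟩
    obtain ⟨q, hq, hqp⟩ := h₂ ⟨p, hp, rfl⟩
    refine ⟨q, hq, ?_⟩
    simp only at hqp ⊢
    rw [← add_assoc, hqp]

/-- **THE LANE-G CLOSER AT CHARGE `c₀ ∈ (0, 1]`, `ExactOnly` form**: modulo `ExactOnly`(C12-55), `StarPairFar` and the named fact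
`ResidualOneSidedCoverage c₀`, EVERY non-co-axial pair satisfies `GenericWallFloorAtCharge c₀` — pure dispatch:
`¬ RayAlignedAt` ⇒ `genericWallFloorAt_chain_of_far`; a priced `Σ9` class ⇒ its landed floor; `SeparatedWideAt` ⇒
`genericWallFloorAt_of_separatedWideAt` (all at charge `1 ≥ c₀`); otherwise the fact and `genericWallFloorAtCharge_of_coveredAtCharge`. -/
theorem genericWallFloorAtCharge_all_of_coverage_star
    {s₀ : EuclideanSpace ℝ (Fin 3)} (hs₀ : s₀ ∈ fccSlots)
    (hcert : ExactOnly 0 (fccSlots.filter fun w => 0 < ⟪w, s₀⟫_ℝ)) (hSP : StarPairFar)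
    {c₀ : ℝ} (hc₀ : 0 < c₀) (hc₁ : c₀ ≤ 1) (hcov : ResidualOneSidedCoverage c₀)
    (A₁ : EuclideanSpace ℝ (Fin 3) ≃ₗᵢ[ℝ] EuclideanSpace ℝ (Fin 3)) (t₁ : EuclideanSpace ℝ (Fin 3))
    (A₂ : EuclideanSpace ℝ (Fin 3) ≃ₗᵢ[ℝ] EuclideanSpace ℝ (Fin 3)) (t₂ : EuclideanSpace ℝ (Fin 3))
    (hnc : ¬ ∃ (L : EuclideanSpace ℝ (Fin 3) ≃ₗᵢ[ℝ] EuclideanSpace ℝ (Fin 3)) (s₁ s₂ : EuclideanSpace ℝ (Fin 3))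
        (σ σ' : ℤ → ℤ), IsHaggSeq σ ∧ IsHaggSeq σ' ∧
        (fun p => A₁ p + t₁) '' fccStacking 1 (Real.sqrt (2 / 3)) ⊆
          (fun p => L p + s₁) '' barlowStacking 1 (Real.sqrt (2 / 3)) σ ∧
        (fun p => A₂ p + t₂) '' fccStacking 1 (Real.sqrt (2 / 3)) ⊆
          (fun p => L p + s₂) '' barlowStacking 1 (Real.sqrt (2 / 3)) σ') :
    GenericWallFloorAtCharge c₀ A₁ t₁ A₂ t₂ := by
  have hone : GenericWallFloorAt A₁ t₁ A₂ t₂ → GenericWallFloorAtCharge c₀ A₁ t₁ A₂ t₂ :=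
    fun h => genericWallFloorAtCharge_mono hc₁ h
  by_cases hra : RayAlignedAt A₁ A₂
  swap
  · obtain ⟨u₁, hu₁, hst₁, u₂, hu₂, hst₂, hsep⟩ := exists_separated_of_not_rayAlignedAt hra
    exact hone (genericWallFloorAt_chain_of_far hs₀ hcert hSP A₁ t₁ A₂ t₂ hu₁ hst₁ hu₂ hst₂ hsep)
  by_cases h₁ : Sigma9OneSidedAt A₁ A₂
  · exact hone (genericWallFloorAt_of_sigma9OneSidedAt hs₀ hcert hSP h₁ t₁ t₂)
  by_cases h₂ : Sigma9OneSidedDownAt A₁ A₂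
  · exact hone (genericWallFloorAt_of_sigma9OneSidedDownAt hs₀ hcert hSP h₂ t₁ t₂)
  by_cases h₃ : Sigma9TiltAt A₁ A₂
  · exact hone (genericWallFloorAt_of_sigma9TiltAt hs₀ hcert hSP h₃ t₁ t₂)
  by_cases h₄ : Sigma9TiltDownAt A₁ A₂
  · exact hone (genericWallFloorAt_of_sigma9TiltDownAt hs₀ hcert hSP h₄ t₁ t₂)
  by_cases h₅ : Sigma9WideAt A₁ A₂
  · exact hone (genericWallFloorAt_of_sigma9WideAt hs₀ hcert hSP h₅ t₁ t₂)
  by_cases h₆ : Sigma9WideDownAt A₁ A₂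
  · exact hone (genericWallFloorAt_of_sigma9WideDownAt hs₀ hcert hSP h₆ t₁ t₂)
  by_cases h₇ : SeparatedWideAt A₁ A₂
  · exact hone (genericWallFloorAt_of_separatedWideAt hs₀ hcert hSP h₇ t₁ t₂)
  exact genericWallFloorAtCharge_of_coveredAtCharge hs₀ hcert hSP hc₀
    (hcov A₁ A₂ (fun h => hnc (coaxial_translate_of_frames t₁ t₂ h)) hra h₁ h₂ h₃ h₄ h₅ h₆ h₇) t₁ t₂

/-- **THE LANE-G CLOSER AT CHARGE `c₀ ∈ (0, 1]`**: `P5Exhaustion → StarPairFar → ResidualOneSidedCoverage c₀ →` for every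
NON-co-axial pair of moved fcc lattices, `GenericWallFloorAtCharge c₀ A₁ t₁ A₂ t₂` (the matrix of the route decl
`GenericWallFloor` for the pair with `+ 1` replaced by `+ c₀`).  Lane G closes at charge `c₀` modulo exactly these three
named inputs. -/
theorem genericWallFloorAtCharge_all_of_coverage (hE1 : P5Exhaustion) (hSP : StarPairFar)
    {c₀ : ℝ} (hc₀ : 0 < c₀) (hc₁ : c₀ ≤ 1) (hcov : ResidualOneSidedCoverage c₀)
    (A₁ : EuclideanSpace ℝ (Fin 3) ≃ₗᵢ[ℝ] EuclideanSpace ℝ (Fin 3)) (t₁ : EuclideanSpace ℝ (Fin 3))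
    (A₂ : EuclideanSpace ℝ (Fin 3) ≃ₗᵢ[ℝ] EuclideanSpace ℝ (Fin 3)) (t₂ : EuclideanSpace ℝ (Fin 3))
    (hnc : ¬ ∃ (L : EuclideanSpace ℝ (Fin 3) ≃ₗᵢ[ℝ] EuclideanSpace ℝ (Fin 3)) (s₁ s₂ : EuclideanSpace ℝ (Fin 3))
        (σ σ' : ℤ → ℤ), IsHaggSeq σ ∧ IsHaggSeq σ' ∧
        (fun p => A₁ p + t₁) '' fccStacking 1 (Real.sqrt (2 / 3)) ⊆
          (fun p => L p + s₁) '' barlowStacking 1 (Real.sqrt (2 / 3)) σ ∧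
        (fun p => A₂ p + t₂) '' fccStacking 1 (Real.sqrt (2 / 3)) ⊆
          (fun p => L p + s₂) '' barlowStacking 1 (Real.sqrt (2 / 3)) σ') :
    GenericWallFloorAtCharge c₀ A₁ t₁ A₂ t₂ := by
  obtain ⟨s₀, hs₀, hcert⟩ := exactOnly_star_of_p5Exhaustion hE1
  exact genericWallFloorAtCharge_all_of_coverage_star hs₀ hcert hSP hc₀ hc₁ hcov A₁ t₁ A₂ t₂ hnc

/-- **Sanity converse at `c₀ = 1`**: the named fact at charge `1` gives the crux BY NAME (so `ResidualOneSidedCoverage 1` is a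
sufficient — not claimed — form of the residual of record). -/
theorem genericWallFloor_of_coverage_one (hE1 : P5Exhaustion) (hSP : StarPairFar) (hcov : ResidualOneSidedCoverage 1) :
    Summit.Ventures.Crystal3D.Theses.StickyWulffConstant.GenericWallFloor := by
  rw [genericWallFloor_iff_at]
  intro A₁ t₁ A₂ t₂ hnc
  exact genericWallFloorAt_of_charge_one
    (genericWallFloorAtCharge_all_of_coverage hE1 hSP one_pos le_rfl hcov A₁ t₁ A₂ t₂ hnc)

end Summit.Ventures.Crystal3D.Theorems

end
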